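/-
PORT (pub-hodgecm2, COR-CM cell) of the stage-1 package file `HodgeCMPerL/HodgeCM/CM/Lemmas.lean`
(pub-hodgecm HOME/lean, bytes of record md5 2dd460c96754, 118 lines). Declarations VERBATIM; edits: imports rewritten to tree
modules, namespace token `HodgeCM` ↦ `Summit.HodgeConjecture.CorCM`, package `conjRingHomK` ↦ tree `Literature.NumberTheory.Automorphic.cmConjRingHom`
(definitionally equal bodies), linter fixes. Generator: pub-hodgecm2-p1 `work/port/build_kit.py`.
-/
/-
Copyright: pub-hodgecm formalisation cell (harness21, 2026). New file (not vendored).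
-/
import Summits.HodgeConjecture.CorCM.CM.Basic

/-!
# Proved combinatorics of faces (fully proved, no placeholders)

rfwf Lemma 1.2 (`Σ 1_{Φᵢ} = 2`), the pair-sum identity for the period types (PerL rem:tetra / rfwf l:tetra),
admissible embeddings lie in all period types, and the sign half of PerL Lemma 3.3(b).
-/

noncomputable section

namespace Summit.HodgeConjecture.CorCM

open Literature.AlgebraicGeometry.Motives (CMType)
open NumberField NumberField.ComplexEmbedding Literature.NumberTheory.ComplexMultiplication.CMTypeOps

variable {K : Type} [Field K]

/-- `1_Φ(φ) = 1` on `Φ`. -/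
theorem ind_of_mem {Φ : CMType K} {φ : K →+* ℂ} (h : φ ∈ Φ.1) : ind Φ φ = 1 := by
  unfold ind; exact if_pos h
/-- `1_Φ(φ) = 0` off `Φ`. -/
theorem ind_of_not_mem {Φ : CMType K} {φ : K →+* ℂ} (h : φ ∉ Φ.1) : ind Φ φ = 0 := by
  unfold ind; exact if_neg h

/-- `1_{Φ̄} = 1 - 1_Φ`. -/
theorem ind_bar (Φ : CMType K) (φ : K →+* ℂ) : ind (bar Φ) φ = 1 - ind Φ φ := by
  by_cases h : φ ∈ Φ.1
  · rw [ind_of_mem h, ind_of_not_mem (show φ ∉ (bar Φ).1 by simpa using h)]; norm_num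
  · rw [ind_of_not_mem h, ind_of_mem (show φ ∈ (bar Φ).1 by simpa using h)]; norm_num

/-- Flipping at the place of `p` does not change membership away from that place. -/
theorem ind_flip_of_not_mem {p φ : K →+* ℂ} (hx : φ ∉ placeSet p) (Φ : CMType K) :
    ind (Literature.NumberTheory.ComplexMultiplication.CMTypeOps.flip p Φ) φ = ind Φ φ := by
  by_cases h : φ ∈ Φ.1
  · rw [ind_of_mem h, ind_of_mem]; rw [mem_flip_iff]; tauto
  · rw [ind_of_not_mem h, ind_of_not_mem]; rw [mem_flip_iff]; tauto

/-- Flipping at the place of `p` complements membership at that place. -/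
theorem ind_flip_of_mem {p φ : K →+* ℂ} (hx : φ ∈ placeSet p) (Φ : CMType K) :
    ind (Literature.NumberTheory.ComplexMultiplication.CMTypeOps.flip p Φ) φ = 1 - ind Φ φ := by
  by_cases h : φ ∈ Φ.1
  · rw [ind_of_mem h, ind_of_not_mem]; · norm_num
    rw [mem_flip_iff]; tauto
  · rw [ind_of_not_mem h, ind_of_mem]; · norm_num
    rw [mem_flip_iff]; tauto

/-- `{p, p̄}` is the fibre of `InfinitePlace.mk` over the place of `p` (one inclusion). -/
theorem mk_eq_of_mem_placeSet {p φ : K →+* ℂ} (h : φ ∈ placeSet p) :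
    InfinitePlace.mk φ = InfinitePlace.mk p := by
  rcases h with h | h
  · rw [h]
  · rw [Set.mem_singleton_iff] at h
    rw [h, InfinitePlace.mk_conjugate_eq]

/-- The two places of a face are distinct: no embedding lies over both. -/
theorem Face.not_mem_both (f : Face K) {φ : K →+* ℂ} (h1 : φ ∈ placeSet f.p) (h2 : φ ∈ placeSet f.p') :
    False :=
  f.place_ne ((mk_eq_of_mem_placeSet h1).symm.trans (mk_eq_of_mem_placeSet h2))

/-- **Pair-sum identity for the period types of a face** (PerL v5 rem:tetra, tex ll. 210–213; rfwf v3
`l:tetra` l. 86): `1_{Ψ₁} + 1_{Ψ₂} = 1_{Ψ₃} + 1_{Ψ₄}` for `Ψ = f.psi` — transposition input (T1). -/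
theorem pairSum_psi (f : Face K) : PairSum f.psi := by
  intro φ
  by_cases x : φ ∈ placeSet f.p <;> by_cases y : φ ∈ placeSet f.p'
  · exact (f.not_mem_both x y).elim
  · simp only [Face.psi, ind_flip_of_not_mem y, ind_flip_of_mem x]; ring
  · simp only [Face.psi, ind_flip_of_not_mem x, ind_flip_of_mem y]
  · simp only [Face.psi, ind_flip_of_not_mem x, ind_flip_of_not_mem y]

/-- **rfwf Lemma 1.2** `lem:hodge22` (combinatorial half): `Σᵢ 1_{Φᵢ} = 2` for the corners of a face. -/
theorem sumTwo_corner (f : Face K) : SumTwo f.corner := by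
  intro φ
  by_cases x : φ ∈ placeSet f.p <;> by_cases y : φ ∈ placeSet f.p'
  · exact (f.not_mem_both x y).elim
  · simp only [Face.corner, ind_flip_of_not_mem y, ind_flip_of_mem x, ind_bar]; ring
  · simp only [Face.corner, ind_flip_of_not_mem x, ind_flip_of_mem y, ind_bar]; ring
  · simp only [Face.corner, ind_flip_of_not_mem x, ind_flip_of_not_mem y, ind_bar]; ring

/-- An admissible embedding lies in all four period types (`ι₁ ∈ Ψᵢ`, needed for the `ι₁`-eigen
holomorphic one-forms `αᵢ` on `B_i = A_{Ψᵢ}` to exist: `Fact_alphaLine`). -/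
theorem admissible_mem_psi (f : Face K) (ι₁ : K →+* ℂ) (h : f.Admissible ι₁) : ∀ i, ι₁ ∈ (f.psi i).1 := by
  obtain ⟨h0, h1, h2⟩ := h
  have x : ι₁ ∉ placeSet f.p := fun hx => h1 (mk_eq_of_mem_placeSet hx)
  have y : ι₁ ∉ placeSet f.p' := fun hy => h2 (mk_eq_of_mem_placeSet hy)
  intro i
  fin_cases i
  · exact h0
  · show ι₁ ∈ (Literature.NumberTheory.ComplexMultiplication.CMTypeOps.flip f.p' (Literature.NumberTheory.ComplexMultiplication.CMTypeOps.flip f.p f.Φ)).1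
    rw [mem_flip_iff, mem_flip_iff]; tauto
  · show ι₁ ∈ (Literature.NumberTheory.ComplexMultiplication.CMTypeOps.flip f.p f.Φ).1
    rw [mem_flip_iff]; tauto
  · show ι₁ ∈ (Literature.NumberTheory.ComplexMultiplication.CMTypeOps.flip f.p' f.Φ).1
    rw [mem_flip_iff]; tauto

/-- `1_Φ` takes values in `{0,1}`. -/
theorem ind_eq (Φ : CMType K) (φ : K →+* ℂ) : ind Φ φ = 0 ∨ ind Φ φ = 1 := by
  by_cases h : φ ∈ Φ.1
  · exact Or.inr (ind_of_mem h)
  · exact Or.inl (ind_of_not_mem h)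

/-- **PerL Lemma 3.3(b), sign half** (tex ll. 280–298; Bool version machine-checked in
`Summit.HodgeConjecture.CorCM.Prior.Signatures`): the pair-sum identity gives equality of the local sign multisets
`{m_ρ(Ψ₁), m_ρ(Ψ₂)} = {m_ρ(Ψ₃), m_ρ(Ψ₄)}` at every embedding `ρ` (here with `m ∈ {0,1}`), i.e. the
hermitian planes `W₁ ⊕ W₂` and `W₃ ⊕ W₄` of Def 3.2 have the same signature at every real place. -/
theorem lemma33b_signs (Ψ : Fin 4 → CMType K) (h : PairSum Ψ) (ρ : K →+* ℂ) :
    ({ind (Ψ 0) ρ, ind (Ψ 1) ρ} : Multiset ℤ) = {ind (Ψ 2) ρ, ind (Ψ 3) ρ} := by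
  have h := h ρ
  rcases ind_eq (Ψ 0) ρ with a | a <;> rcases ind_eq (Ψ 1) ρ with b | b <;>
    rcases ind_eq (Ψ 2) ρ with c | c <;> rcases ind_eq (Ψ 3) ρ with d | d <;>
    rw [a, b, c, d] at h ⊢ <;> first | rfl | exact Multiset.pair_comm _ _ | (norm_num at h)

end Summit.HodgeConjecture.CorCM

end
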